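import Mathlib
import Summits.RiemannHypothesis.RiemannHypothesis.Theorems.GroundBartaEvenWinsBeyondArchPhantomMinorant
import Literature.NumberTheory.LFunctions.WeilFinitePrimeQuadratic
import Literature.NumberTheory.LFunctions.WeilArchimedeanPositivityProofs
import Literature.NumberTheory.LFunctions.WeilFourierGridWindow
import HarnessLib

/-!
# Format C (Fourier–Galerkin / Schur certificates of Weil positivity): complement coercivity from a PHANTOM level

Helper file (`--supports stmt-RiemannHypothesis-0098`, lead-track anchor; infrastructure for the
Weil-positivity window ladder, routes WeilPos / GroundBarta / WeilParity), RH-free.  Seat rh-explicit-weil-3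
(structure seat; memo `run/shared/lean/pub/rh-explicit/WEIL3-STRUCTURE.md` §9.2: "the complement wall").

The complement constant `μ_N` of a format-C certificate on the window `[-a, a]` (Yoshida 1992, Lemma 3 and
(6.3)–(6.7)) is `L − (losses)`, where `L` is a level below the frequency-side weight beyond `|t| ≥ T`.  With
the POINTWISE prime loss the level is `Re ψ(1/4+iT/2) − Σ_{n<e^{2a}} 2Λ(n)/√n` — format A's level-test
constant, which makes the block size doubly exponential in `a` (`Literature…WeilWindowCoercivityExplicit`,
the tree's K(a)).  Here the prime term is kept on the frequency side, `−W_prime + W_arch =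
(1/2π) ∫ |ĝ|² w_N − (log π)‖g‖₂²` with `w_N = Re ψ(1/4+it/2) − Σ_{n≤N}(Λ(n)/√n) 2cos(t log n)`
(`weilQuadratic_re_eq_weilFinitePrimeQuadratic`), and a PHANTOM RIPPLE `P` (frequencies `|x| ≥ 2a`,
invisible to every test on the window: `integral_norm_sq_weilMellin_mul_phantomRipple_eq_zero`, seat weil-1)
is allowed in the level test `L + P ≤ w_N` beyond `T` — the device that replaces the pointwise constant by
the (much smaller) phantom dip.

* `weilQuadratic_re_ge_of_window_majorant_phantom` — for `tsupport g ⊆ [-a, a]`, `a ≤ (log(N+1))/2`,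
  a phantom `P` with `L + P(t) ≤ w_N(t)` for `|t| ≥ T` and `m₀ + P(t) ≤ w_N(t)` for all `t` (`m₀ ≤ L`),
  and a continuous window majorant `|ĝ(1/2+it)|² ≤ D(t)‖g‖₂²` on `[-T, T]`:
  `(L − log π − 2(sinh a − a) − (L − m₀)/(2π) ∫_{-T}^{T} D) ‖g‖₂² ≤ Re Q(g)`.
* `weilQuadratic_re_ge_of_fourierGrid_zero_phantom` — the same with `D` any continuous upper bound of the
  Fourier-grid sinc majorant of `Literature…WeilFourierGridWindow` (vanishing `ĝ(1/2+iπn/a) = 0`, `n ∈ S`).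

Everything is elementary given the tree's lemmas; no facts, no axioms beyond the standard three.
-/

set_option linter.dupNamespace false

noncomputable section

open Complex Filter Set MeasureTheory
open scoped Real Topology ComplexConjugate

namespace Summit.RiemannHypothesis.RiemannHypothesis.Theorems.WeilFormatC

open Literature.NumberTheory.LFunctions Literature.Analysis.SpecialFunctions
open Summit.RiemannHypothesis.RiemannHypothesis.Theorems.EvenWinsBeyondArch (phantomRipple
  le_integral_norm_sq_weilMellin_mul_of_phantom_minorant)

variable {g : ℝ → ℂ}

/-- **Complement coercivity from a phantom level** (frequency-side Yoshida (6.7)).  Let `g` be a Weil test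
function with `tsupport g ⊆ [-a, a]`, `a ≤ (log(N+1))/2` (so `Re Q(g) = E_N(g)`), `P = phantomRipple ps` with
all frequencies `≥ 2a` in absolute value, levels `m₀ ≤ L` with `L + P(t) ≤ w_N(t)` for `|t| ≥ T` and
`m₀ + P(t) ≤ w_N(t)` for every `t`, and `D` continuous on `[-T, T]` with `|ĝ(1/2+it)|² ≤ D(t) ‖g‖₂²` there.
Then `(L − log π − 2(sinh a − a) − (L − m₀)/(2π) ∫_{-T}^{T} D) ‖g‖₂² ≤ Re Q(g)`.
[cite: Yoshida1992HermitianForms, §6 (6.3)–(6.7), frequency-side with invisible frequencies in the level test] -/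
theorem weilQuadratic_re_ge_of_window_majorant_phantom (hg : IsWeilTest g) {a : ℝ}
    (hsupp : tsupport g ⊆ Icc (-a) a) {N : ℕ} (hNa : a ≤ Real.log ((N : ℝ) + 1) / 2)
    {ps : List (ℝ × ℝ)} (hps : ∀ p ∈ ps, 2 * a ≤ |p.2|)
    {T L m₀ : ℝ} (hT : 0 < T) (hm₀ : m₀ ≤ L)
    (hlev : ∀ t : ℝ, T ≤ |t| → L + phantomRipple ps t ≤ weilFinitePrimeWeight N t)
    (hlow : ∀ t : ℝ, m₀ + phantomRipple ps t ≤ weilFinitePrimeWeight N t)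
    {D : ℝ → ℝ} (hDc : ContinuousOn D (Icc (-T) T))
    (hD : ∀ t ∈ Icc (-T) T, ‖weilMellin g (1 / 2 + t * I)‖ ^ 2 ≤ D t * weilNorm2Sq g) :
    (L - Real.log π - 2 * (Real.sinh a - a) - (L - m₀) / (2 * π) * ∫ t in (-T)..T, D t) * weilNorm2Sq g
      ≤ (weilQuadratic g).re := by
  -- `Re Q = E_N`
  have hsuppN : tsupport g ⊆ Icc (-(Real.log ((N : ℝ) + 1) / 2)) (Real.log ((N : ℝ) + 1) / 2) :=
    hsupp.trans (Icc_subset_Icc (neg_le_neg hNa) hNa)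
  rw [weilQuadratic_re_eq_weilFinitePrimeQuadratic hg N hsuppN, weilFinitePrimeQuadratic]
  set n2 : ℝ := weilNorm2Sq g with hn2
  have hn2nn : 0 ≤ n2 := weilNorm2Sq_nonneg g
  set H : ℝ → ℂ := fun t ↦ weilMellin g (1 / 2 + t * I) with hH
  set W : ℝ := ∫ t in (-T)..T, D t with hW
  -- polar term
  have hpol : -(2 * (Real.sinh a - a)) * n2 ≤ 2 * (weilMellin g 0 * conj (weilMellin g 1)).re := by
    have := Yoshida1992_polar_lower_bound hg hsupp
    rwa [hn2, weilNorm2Sq]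
  -- the correction `γ = (L − m₀)·1_{[-T,T]}`
  set γ : ℝ → ℝ := (Icc (-T) T).indicator fun _ ↦ L - m₀ with hγ
  have hint_H : Integrable fun t : ℝ ↦ ‖H t‖ ^ 2 := integrable_norm_sq_weilMellin_half_line hg
  have hγ_meas : AEStronglyMeasurable γ volume :=
    (aestronglyMeasurable_const.indicator measurableSet_Icc)
  have hint_γ : Integrable fun t : ℝ ↦ ‖H t‖ ^ 2 * γ t := by
    have hb : ∀ᵐ t : ℝ, ‖γ t‖ ≤ L - m₀ := ae_of_all _ fun t ↦ by
      rw [hγ, Real.norm_eq_abs]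
      by_cases ht : t ∈ Icc (-T) T
      · rw [indicator_of_mem ht, abs_of_nonneg (by linarith)]
      · rw [indicator_of_notMem ht, abs_zero]; linarith
    have h := Integrable.bdd_mul (c := L - m₀) hint_H hγ_meas hb
    exact h.congr (ae_of_all _ fun t ↦ by ring)
  have hint_w : Integrable fun t : ℝ ↦ ‖H t‖ ^ 2 * weilFinitePrimeWeight N t :=
    integrable_norm_sq_weilMellin_mul_weilFinitePrimeWeight hg N
  -- the minorant `L + P − γ ≤ w_N`
  have hmin : ∀ t : ℝ, L + phantomRipple ps t - γ t ≤ weilFinitePrimeWeight N t := by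
    intro t
    by_cases ht : t ∈ Icc (-T) T
    · rw [hγ, indicator_of_mem ht]
      have := hlow t
      linarith
    · rw [hγ, indicator_of_notMem ht, sub_zero]
      have hTt : T ≤ |t| := by
        simp only [mem_Icc, not_and_or, not_le] at ht
        rcases ht with h | h
        · rw [abs_of_neg (by linarith)]; linarith
        · exact h.le.trans (le_abs_self t)
      exact hlev t hTt
  have hmain := le_integral_norm_sq_weilMellin_mul_of_phantom_minorant hg hsupp hps hint_w hint_γ hmin
  -- evaluate `∫ |H|² = 2π n2` and bound `∫ |H|² γ ≤ (L − m₀) n2 W`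
  have hP : ∫ t : ℝ, ‖weilMellin g (1 / 2 + t * I)‖ ^ 2 = 2 * π * n2 := by
    rw [integral_norm_sq_weilMellin_half_line hg, hn2]
  have hG : ∫ t : ℝ, ‖weilMellin g (1 / 2 + t * I)‖ ^ 2 * γ t ≤ (L - m₀) * (n2 * W) := by
    have e1 : (fun t : ℝ ↦ ‖weilMellin g (1 / 2 + t * I)‖ ^ 2 * γ t) =
        (Icc (-T) T).indicator fun t ↦ (L - m₀) * ‖H t‖ ^ 2 := by
      funext t
      by_cases ht : t ∈ Icc (-T) T
      · rw [hγ, indicator_of_mem ht, indicator_of_mem ht, hH]; ring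
      · rw [hγ, indicator_of_notMem ht, indicator_of_notMem ht, mul_zero]
    rw [e1, integral_indicator measurableSet_Icc, integral_const_mul]
    refine mul_le_mul_of_nonneg_left ?_ (by linarith)
    -- `∫_{Icc} |H|² ≤ ∫_{Icc} D n2 = n2 W`
    have hDn : IntegrableOn (fun t ↦ D t * n2) (Icc (-T) T) :=
      (hDc.mul continuousOn_const).integrableOn_compact isCompact_Icc
    have hle : ∫ t in Icc (-T) T, ‖H t‖ ^ 2 ≤ ∫ t in Icc (-T) T, D t * n2 :=
      setIntegral_mono_on hint_H.integrableOn hDn measurableSet_Icc fun t ht ↦ hD t ht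
    have heq : ∫ t in Icc (-T) T, D t * n2 = n2 * W := by
      rw [integral_mul_const, hW, intervalIntegral.integral_of_le (by linarith),
        integral_Icc_eq_integral_Ioc]
      ring
    linarith [hle, heq]
  rw [hP] at hmain
  -- assembly
  have hπ : 0 < 2 * π := by positivity
  have h3 : L * (2 * π * n2) - (L - m₀) * (n2 * W) ≤
      ∫ t : ℝ, ‖weilMellin g (1 / 2 + t * I)‖ ^ 2 * weilFinitePrimeWeight N t := by linarith
  have h4 : 1 / (2 * π) * (L * (2 * π * n2) - (L - m₀) * (n2 * W)) ≤
      1 / (2 * π) * ∫ t : ℝ, ‖weilMellin g (1 / 2 + t * I)‖ ^ 2 * weilFinitePrimeWeight N t :=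
    mul_le_mul_of_nonneg_left h3 (by positivity)
  have e : (L - Real.log π - 2 * (Real.sinh a - a) - (L - m₀) / (2 * π) * W) * n2 =
      -(2 * (Real.sinh a - a)) * n2 - Real.log π * n2 +
        1 / (2 * π) * (L * (2 * π * n2) - (L - m₀) * (n2 * W)) := by
    field_simp
    ring
  rw [e]
  linarith

/-- **Complement coercivity from a phantom level, Fourier-grid form.**  As
`weilQuadratic_re_ge_of_window_majorant_phantom`, for a test function whose transform vanishes on the grid
`πn/a`, `n ∈ S`, with `D` any continuous upper bound on `[-T, T]` of the sinc majorant
`2a − (1/2a) Σ_{n∈S} (2 sin((t−πn/a)a)/(t−πn/a))²` of `norm_sq_weilMellin_le_of_fourierGrid_zero_sinc`.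
[cite: Yoshida1992HermitianForms, §3 Lemma 3 and §6 (6.3)–(6.7)] -/
theorem weilQuadratic_re_ge_of_fourierGrid_zero_phantom (hg : IsWeilTest g) {a : ℝ} (ha : 0 < a)
    (hsupp : tsupport g ⊆ Icc (-a) a) {N : ℕ} (hNa : a ≤ Real.log ((N : ℝ) + 1) / 2)
    (S : Finset ℤ) (hzero : ∀ n ∈ S, weilMellin g (1 / 2 + ((π * n / a : ℝ) : ℂ) * I) = 0)
    {ps : List (ℝ × ℝ)} (hps : ∀ p ∈ ps, 2 * a ≤ |p.2|)
    {T L m₀ : ℝ} (hT : 0 < T) (hm₀ : m₀ ≤ L)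
    (hlev : ∀ t : ℝ, T ≤ |t| → L + phantomRipple ps t ≤ weilFinitePrimeWeight N t)
    (hlow : ∀ t : ℝ, m₀ + phantomRipple ps t ≤ weilFinitePrimeWeight N t)
    {D : ℝ → ℝ} (hDc : ContinuousOn D (Icc (-T) T))
    (hD : ∀ t ∈ Icc (-T) T, 2 * a - 1 / (2 * a) * ∑ n ∈ S,
        (if t = π * n / a then 2 * a else 2 * Real.sin ((t - π * n / a) * a) / (t - π * n / a)) ^ 2 ≤ D t) :
    (L - Real.log π - 2 * (Real.sinh a - a) - (L - m₀) / (2 * π) * ∫ t in (-T)..T, D t) * weilNorm2Sq g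
      ≤ (weilQuadratic g).re := by
  refine weilQuadratic_re_ge_of_window_majorant_phantom hg hsupp hNa hps hT hm₀ hlev hlow hDc
    fun t ht ↦ ?_
  have h := norm_sq_weilMellin_le_of_fourierGrid_zero_sinc hg ha hsupp S hzero t
  calc ‖weilMellin g (1 / 2 + t * I)‖ ^ 2
      ≤ weilNorm2Sq g * (2 * a - 1 / (2 * a) * ∑ n ∈ S,
          (if t = π * n / a then 2 * a else 2 * Real.sin ((t - π * n / a) * a) / (t - π * n / a)) ^ 2) := h
    _ ≤ weilNorm2Sq g * D t := mul_le_mul_of_nonneg_left (hD t ht) (weilNorm2Sq_nonneg g)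
    _ = D t * weilNorm2Sq g := mul_comm _ _

end Summit.RiemannHypothesis.RiemannHypothesis.Theorems.WeilFormatC
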